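import Summits.ResolutionOfSingularities.ResolutionOfSingularities.Theorems.PurelyInseparableDim4ResConeLightPairTail
import HarnessLib
import HarnessLib.Audit.Tags

/-!
# Purely inseparable four-folds — LOSSY PAIR TAILS: the kernel is always a TILTED FRAME (idea-4's sector TT), the
# free part of every translation is FORCED by it, and the losses recur on the pair itself («lose-both» steps)
# (K2(p) lane, SLICE C (C15): generic preliminaries for the lossy residual of D∞-type; file-holder res-dim4-p-5 g3)

[OURS · counted 0 · cell `res-dim4-pi` · K2(p) lane (desk WORDS #78 (d), #80 (d), #96 (b), #105 (d)) · seat p-5 g3.]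
Nothing here proves K2(p), `NoIsolatedTrap p p` or resolution of singularities in dimension ≥ 4 / char. `p`.

After `…LossFreeTail.no_lossfree_tail` every binary-cone trap is LOSSY.  This file treats lossy tails whose chart
letters still lie in a pair `{a, a′}` from `k₀` on (no permanence of the pair is assumed — `a′` may be shed and
re-created, as in idea-4's class D∞), on a constant-`(d, e_G = 2)` tail of an isolated above-floor witnessed
`Step0 p` chain with `x^{r₀} ∣ F₀`:
* `exists_tilted_frame` — SECTOR TT ALWAYS: `resVertex (c k) ∋ e_a + φ, e_{a′} + ψ` with `φ, ψ` supported on the two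
  passive letters (the kernel projects isomorphically onto `⟨e_a, e_{a′}⟩`; `…BinaryPairTail.no_passive_kernel_vector`);
* `translation_forced` — at a step with chart `a` the passive part of the translation is `b_k|_{passive} =
  φ + (b k a′)·ψ` for ANY such tilted frame (idea-4's «forced free part»);
* `loseBoth_recurrent_of_lossy` — if the tail translates boundary letters infinitely often, it translates the OTHER
  PAIR LETTER while it is a boundary letter infinitely often (`j k = a ∧ b k a′ ≠ 0 ∧ 1 ≤ r_k a′` or symmetrically):
  passive letters are shed at most once each (`…LightPairTail.free_of_translated`).
[cite: CossartJannsenSaito2020, Thm. 3.10(4), Thm. 3.14, Thm. 9.3]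
bears_on: LADDER-RESOLUTION:D157-DOOR2 (res-dim4-pi · K2(p) = `RidgeBudget.NoAboveFloorTrap p p` · slice C, lossy residual).
Supports stmt-ResolutionOfSingularities-16155 (helper).
-/

set_option linter.dupNamespace false -- mandated namespace of this single-conjunct summit

noncomputable section

namespace Summit.ResolutionOfSingularities.ResolutionOfSingularities.Theorems.PIDim4

namespace ResCone

open MvPolynomial Finset
open Literature.AlgebraicGeometry.Resolution
open Literature.AlgebraicGeometry.Resolution.CentreBlowup
open Literature.AlgebraicGeometry.Resolution.Hauser2010
open Literature.AlgebraicGeometry.Resolution.HauserPerlega2019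
open PointBlowup (direction)

variable {K : Type} [Field K]

section LossyPair

variable (p : ℕ) [Fact p.Prime] [CharP K p] [DecidableEq K]

/-- The tilted frame read in the chart of the current step: if `j k = a` then `resVertex (c k)` contains `e_a + φ`
and `e_{a′} + ψ` with `φ, ψ` vanishing on `{a, a′}`. [OURS] [cite: CossartJannsenSaito2020, Thm. 3.10(4), Thm. 3.14] -/
theorem exists_tilted_frame_at {c : ℕ → State K} {j : ℕ → Fin 4} {b : ℕ → Fin 4 → K}
    (hc : ∀ k, IsIsolated p (c k).F ∧ Step0 p (c k) (c (k + 1))) (hw : FreeTail.IsWitnessedChain p c j b)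
    (hr0 : ∀ e ∈ (c 0).F.support, (c 0).r ≤ e) (hfloor : ∀ k, ordZero (c k).F ≠ p) {k₀ : ℕ} {d : ℕ∞}
    (hshade : ∀ k, k₀ ≤ k → (c k).shade = d) (he : ∀ k, k₀ ≤ k → Module.finrank K (resVertex (c k)) = 2)
    {a a' : Fin 4} (haa : a ≠ a') (hletters : ∀ k, k₀ ≤ k → (j k = a ∨ j k = a')) {k : ℕ} (hk : k₀ ≤ k)
    (hjk : j k = a) :
    ∃ φ ψ : Fin 4 → K, φ a = 0 ∧ φ a' = 0 ∧ ψ a = 0 ∧ ψ a' = 0 ∧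
      Pi.single a 1 + φ ∈ resVertex (c k) ∧ Pi.single a' 1 + ψ ∈ resVertex (c k) := by
  obtain ⟨o, ho, hpo, ho2⟩ := chain_band p hc hfloor k
  have hrk := IsolatedBand.isolated_chain_forall_le hc hr0
  have hv : direction (j k) (b k) ∈ resVertex (c k) := chain_direction_mem_resVertex p hc hw hr0 hfloor hshade hk
  have hline : Module.finrank K ↥(resVertex (c k) ⊓ hyperplane (j k)) = 1 := by
    have h := finrank_resVertex_inf_hyperplane_add_one (j k) (hw k).2.1 ho (hrk k) hpo ho2
      (chain_shade_step p hw hshade hk)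
    rw [he k hk] at h
    omega
  obtain ⟨π, hπ, hπ0⟩ : ∃ π ∈ resVertex (c k) ⊓ hyperplane (j k), π ≠ 0 := by
    by_contra h
    push Not at h
    have hbot : resVertex (c k) ⊓ hyperplane (j k) = ⊥ := by rw [Submodule.eq_bot_iff]; exact h
    rw [hbot, finrank_bot] at hline
    exact zero_ne_one hline
  have hπV : π ∈ resVertex (c k) := (Submodule.mem_inf.mp hπ).1
  have hπa : π a = 0 := by rw [← hjk]; exact mem_hyperplane.mp (Submodule.mem_inf.mp hπ).2
  have hπa' : π a' ≠ 0 := fun h0 =>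
    hπ0 (no_passive_kernel_vector p hc hw hr0 hfloor hshade he hletters hk hπV hπa h0)
  set t : K := b k a' with ht
  set u₂ : Fin 4 → K := (π a')⁻¹ • π with hu₂
  set u₁ : Fin 4 → K := direction (j k) (b k) - t • u₂ with hu₁
  have hu₂V : u₂ ∈ resVertex (c k) := Submodule.smul_mem _ _ hπV
  have hu₁V : u₁ ∈ resVertex (c k) := Submodule.sub_mem _ hv (Submodule.smul_mem _ _ hu₂V)
  have hu₂a : u₂ a = 0 := by simp only [hu₂, Pi.smul_apply, smul_eq_mul, hπa, mul_zero]
  have hu₂a' : u₂ a' = 1 := by simp only [hu₂, Pi.smul_apply, smul_eq_mul, inv_mul_cancel₀ hπa']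
  have hu₁a : u₁ a = 1 := by
    simp only [hu₁, Pi.sub_apply, Pi.smul_apply, smul_eq_mul, hu₂a, mul_zero, sub_zero]
    rw [← hjk, direction_apply_self]
  have hu₁a' : u₁ a' = 0 := by
    simp only [hu₁, Pi.sub_apply, Pi.smul_apply, smul_eq_mul, hu₂a', mul_one]
    rw [direction_apply_of_ne (by rw [hjk]; exact haa.symm), ht, sub_self]
  refine ⟨u₁ - Pi.single a 1, u₂ - Pi.single a' 1, ?_, ?_, ?_, ?_, ?_, ?_⟩
  · rw [Pi.sub_apply, hu₁a, Pi.single_eq_same, sub_self]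
  · rw [Pi.sub_apply, hu₁a', Pi.single_eq_of_ne haa.symm, sub_zero]
  · rw [Pi.sub_apply, hu₂a, Pi.single_eq_of_ne haa, sub_zero]
  · rw [Pi.sub_apply, hu₂a', Pi.single_eq_same, sub_self]
  · rw [add_sub_cancel]; exact hu₁V
  · rw [add_sub_cancel]; exact hu₂V

/-- **SECTOR TT ALWAYS**: on a constant-`(d, e_G = 2)` tail with chart letters in `{a, a′}`, every polar kernel is a
TILTED FRAME: `resVertex (c k) ∋ e_a + φ, e_{a′} + ψ` with `φ, ψ` supported on the two passive letters — the kernel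
projects isomorphically onto `⟨e_a, e_{a′}⟩` (idea-4's sector TT, every `p`, every `d`). [OURS]
[cite: CossartJannsenSaito2020, Thm. 3.10(4), Thm. 3.14, Thm. 9.3] -/
theorem exists_tilted_frame {c : ℕ → State K} {j : ℕ → Fin 4} {b : ℕ → Fin 4 → K}
    (hc : ∀ k, IsIsolated p (c k).F ∧ Step0 p (c k) (c (k + 1))) (hw : FreeTail.IsWitnessedChain p c j b)
    (hr0 : ∀ e ∈ (c 0).F.support, (c 0).r ≤ e) (hfloor : ∀ k, ordZero (c k).F ≠ p) {k₀ : ℕ} {d : ℕ∞}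
    (hshade : ∀ k, k₀ ≤ k → (c k).shade = d) (he : ∀ k, k₀ ≤ k → Module.finrank K (resVertex (c k)) = 2)
    {a a' : Fin 4} (haa : a ≠ a') (hletters : ∀ k, k₀ ≤ k → (j k = a ∨ j k = a')) {k : ℕ} (hk : k₀ ≤ k) :
    ∃ φ ψ : Fin 4 → K, φ a = 0 ∧ φ a' = 0 ∧ ψ a = 0 ∧ ψ a' = 0 ∧
      Pi.single a 1 + φ ∈ resVertex (c k) ∧ Pi.single a' 1 + ψ ∈ resVertex (c k) := by
  rcases hletters k hk with hja | hja'
  · exact exists_tilted_frame_at p hc hw hr0 hfloor hshade he haa hletters hk hja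
  · obtain ⟨ψ, φ, hψa', hψa, hφa', hφa, hψV, hφV⟩ := exists_tilted_frame_at p hc hw hr0 hfloor hshade he haa.symm
      (fun k hk => (hletters k hk).symm) hk hja'
    exact ⟨φ, ψ, hφa, hφa', hψa, hψa', hφV, hψV⟩

/-- **THE FREE PART OF A TRANSLATION IS FORCED** (idea-4's «forced free part»): for ANY tilted frame
`e_a + φ, e_{a′} + ψ ∈ resVertex (c k)` (`φ, ψ` vanishing on `{a, a′}`) and a step with chart `a`, the translation
satisfies `b k i = φ i + (b k a′) · ψ i` at every passive letter `i`. [OURS]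
[cite: CossartJannsenSaito2020, Thm. 3.10(4), Thm. 3.14] -/
theorem translation_forced {c : ℕ → State K} {j : ℕ → Fin 4} {b : ℕ → Fin 4 → K}
    (hc : ∀ k, IsIsolated p (c k).F ∧ Step0 p (c k) (c (k + 1))) (hw : FreeTail.IsWitnessedChain p c j b)
    (hr0 : ∀ e ∈ (c 0).F.support, (c 0).r ≤ e) (hfloor : ∀ k, ordZero (c k).F ≠ p) {k₀ : ℕ} {d : ℕ∞}
    (hshade : ∀ k, k₀ ≤ k → (c k).shade = d) (he : ∀ k, k₀ ≤ k → Module.finrank K (resVertex (c k)) = 2)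
    {a a' : Fin 4} (haa : a ≠ a') (hletters : ∀ k, k₀ ≤ k → (j k = a ∨ j k = a')) {k : ℕ} (hk : k₀ ≤ k)
    (hjk : j k = a) {φ ψ : Fin 4 → K} (hφa : φ a = 0) (hφa' : φ a' = 0) (hψa : ψ a = 0) (hψa' : ψ a' = 0)
    (hφV : Pi.single a 1 + φ ∈ resVertex (c k)) (hψV : Pi.single a' 1 + ψ ∈ resVertex (c k)) {i : Fin 4}
    (hia : i ≠ a) (hia' : i ≠ a') : b k i = φ i + b k a' * ψ i := by
  have hv : direction (j k) (b k) ∈ resVertex (c k) := chain_direction_mem_resVertex p hc hw hr0 hfloor hshade hk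
  set w : Fin 4 → K := direction (j k) (b k) - (Pi.single a 1 + φ) - b k a' • (Pi.single a' 1 + ψ) with hwdef
  have hwV : w ∈ resVertex (c k) :=
    Submodule.sub_mem _ (Submodule.sub_mem _ hv hφV) (Submodule.smul_mem _ _ hψV)
  have hwa : w a = 0 := by
    simp only [hwdef, Pi.sub_apply, Pi.add_apply, Pi.smul_apply, smul_eq_mul, Pi.single_eq_same, hφa,
      Pi.single_eq_of_ne haa, hψa, add_zero, mul_zero, sub_zero]
    rw [← hjk, direction_apply_self, sub_self]
  have hwa' : w a' = 0 := by
    simp only [hwdef, Pi.sub_apply, Pi.add_apply, Pi.smul_apply, smul_eq_mul, Pi.single_eq_same, hφa',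
      Pi.single_eq_of_ne haa.symm, hψa', add_zero, mul_one]
    rw [direction_apply_of_ne (by rw [hjk]; exact haa.symm), sub_zero, sub_self]
  have h0 := no_passive_kernel_vector p hc hw hr0 hfloor hshade he hletters hk hwV hwa hwa'
  have hi := congrFun h0 i
  simp only [hwdef, Pi.sub_apply, Pi.add_apply, Pi.smul_apply, smul_eq_mul, Pi.single_eq_of_ne hia,
    Pi.single_eq_of_ne hia', zero_add, Pi.zero_apply] at hi
  rw [direction_apply_of_ne (by rw [hjk]; exact hia)] at hi
  linear_combination hi

omit [CharP K p] in
/-- **LOSSES RECUR ON THE PAIR («lose-both» steps)**: if a constant-`(d, e_G = 2)` tail with chart letters in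
`{a, a′}` translates boundary letters infinitely often, then infinitely often it translates the OTHER PAIR LETTER while
that letter is a boundary letter — passive letters are shed at most once each. [OURS]
[cite: CossartJannsenSaito2020, Thm. 3.14] -/
theorem loseBoth_recurrent_of_lossy {c : ℕ → State K} {j : ℕ → Fin 4} {b : ℕ → Fin 4 → K}
    (hc : ∀ k, IsIsolated p (c k).F ∧ Step0 p (c k) (c (k + 1))) (hw : FreeTail.IsWitnessedChain p c j b)
    (hr0 : ∀ e ∈ (c 0).F.support, (c 0).r ≤ e) (hfloor : ∀ k, ordZero (c k).F ≠ p) {k₀ : ℕ} {a a' : Fin 4}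
    (haa : a ≠ a') (hletters : ∀ k, k₀ ≤ k → (j k = a ∨ j k = a'))
    (hlossy : ∀ N, ∃ k, N ≤ k ∧ ∃ i, i ≠ j k ∧ b k i ≠ 0 ∧ 1 ≤ (c k).r i) (N : ℕ) :
    ∃ k, N ≤ k ∧ ((j k = a ∧ b k a' ≠ 0 ∧ 1 ≤ (c k).r a') ∨ (j k = a' ∧ b k a ≠ 0 ∧ 1 ≤ (c k).r a)) := by
  -- a loss of a pair letter is a «lose-both» step
  have hpair : ∀ k, k₀ ≤ k → ∀ i, i ≠ j k → b k i ≠ 0 → 1 ≤ (c k).r i → (i = a ∨ i = a') →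
      (j k = a ∧ b k a' ≠ 0 ∧ 1 ≤ (c k).r a') ∨ (j k = a' ∧ b k a ≠ 0 ∧ 1 ≤ (c k).r a) := by
    intro k hk i hij hbi hri hi
    rcases hletters k hk with hja | hja' <;> rcases hi with rfl | rfl
    · exact absurd hja.symm hij
    · exact Or.inl ⟨hja, hbi, hri⟩
    · exact Or.inr ⟨hja', hbi, hri⟩
    · exact absurd hja'.symm hij
  -- a passive letter is shed at most once: after a translation it is free for ever
  have hfree : ∀ k, k₀ ≤ k → ∀ i, i ≠ a → i ≠ a' → b k i ≠ 0 → ∀ n, k + 1 ≤ n → (c n).r i = 0 :=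
    fun k hk i hia hia' hbi n hn => (free_of_translated p hc hw hr0 hfloor hletters hia hia' hk hbi n hn).1
  -- three losses after `max N k₀` suffice
  obtain ⟨k₁, hk₁, i₁, hi₁j, hbi₁, hri₁⟩ := hlossy (max N k₀)
  by_cases h₁ : i₁ = a ∨ i₁ = a'
  · exact ⟨k₁, le_of_max_le_left hk₁, hpair k₁ (le_of_max_le_right hk₁) i₁ hi₁j hbi₁ hri₁ h₁⟩
  push Not at h₁
  obtain ⟨k₂, hk₂, i₂, hi₂j, hbi₂, hri₂⟩ := hlossy (k₁ + 1)
  by_cases h₂ : i₂ = a ∨ i₂ = a'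
  · exact ⟨k₂, by omega, hpair k₂ (by omega) i₂ hi₂j hbi₂ hri₂ h₂⟩
  push Not at h₂
  have hi₂₁ : i₂ ≠ i₁ := by
    rintro rfl
    have := hfree k₁ (le_of_max_le_right hk₁) i₂ h₁.1 h₁.2 hbi₁ k₂ hk₂
    omega
  obtain ⟨k₃, hk₃, i₃, hi₃j, hbi₃, hri₃⟩ := hlossy (k₂ + 1)
  by_cases h₃ : i₃ = a ∨ i₃ = a'
  · exact ⟨k₃, by omega, hpair k₃ (by omega) i₃ hi₃j hbi₃ hri₃ h₃⟩
  push Not at h₃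
  exfalso
  -- `i₃` is a passive letter, hence `i₁` or `i₂` — both already free
  obtain ⟨f₁, f₂, hf₁₂, hf₁a, hf₁a', hf₂a, hf₂a', hcompl⟩ := exists_pair_compl haa
  have hmem : ∀ i : Fin 4, i ≠ a → i ≠ a' → (i = f₁ ∨ i = f₂) := by
    intro i hia hia'
    by_contra hno
    push Not at hno
    rcases hcompl i hno.1 hno.2 with h | h
    · exact hia h
    · exact hia' h
  have hi₃ : i₃ = i₁ ∨ i₃ = i₂ := by
    rcases hmem i₁ h₁.1 h₁.2 with h1 | h1 <;> rcases hmem i₂ h₂.1 h₂.2 with h2 | h2 <;>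
      rcases hmem i₃ h₃.1 h₃.2 with h3 | h3
    all_goals first
      | exact Or.inl (h3.trans h1.symm)
      | exact Or.inr (h3.trans h2.symm)
      | exact absurd (h2.trans h1.symm) hi₂₁
  rcases hi₃ with rfl | rfl
  · have := hfree k₁ (le_of_max_le_right hk₁) i₃ h₁.1 h₁.2 hbi₁ k₃ (by omega)
    omega
  · have := hfree k₂ (by omega) i₃ h₂.1 h₂.2 hbi₂ k₃ hk₃
    omega

end LossyPair

end ResCone

end Summit.ResolutionOfSingularities.ResolutionOfSingularities.Theorems.PIDim4

end
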